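import Summits.BirchSwinnertonDyer.BirchSwinnertonDyer.Theorems.AdditiveKolyvaginRoadBottomTransferKrizLiLender
import Summits.BirchSwinnertonDyer.BirchSwinnertonDyer.Theorems.AdditiveKolyvaginRoadEigen
import Summits.BirchSwinnertonDyer.BirchSwinnertonDyer.Theorems.KolyvaginRoadThreeMethod2ParityRank
import Literature.NumberTheory.EllipticCurves.KolyvaginShaIndexBound
import Literature.NumberTheory.EllipticCurves.BSDRankZeroDensityProofs
import Literature.NumberTheory.EllipticCurves.NonEisensteinPrimeOfSurjective
import Literature.NumberTheory.EllipticCurves.BSDSelmerCMPConverseHeegnerFieldProofs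
import Literature.Algebra.Module.AlternatingPairingParity
import Mathlib.GroupTheory.Perm.Cycle.Type
import HarnessLib

/-!
# Route `AdditiveKolyvaginRoad`, crux KS′ `LevelKolyvaginSystemsAdditive` (item stmt-BirchSwinnertonDyer-21396):
# the LENDER's BOTTOM RANK IS ONE on the (γ)-avatar locus — `dim Sel_∅⁺(E₀) + dim Sel_∅⁻(E₀) = 1` from the log certificate
# and Kolyvagin's theorem for `E₀` (line `epsilon_matched_retyping`, skeleton v4, input of stub S5b `stub_lenderCoreConnected`;
# cell `pub/bsd-wall`, lead `cruxlead-stmt-BirchSwinnertonDyer-21396`; `--supports stmt-BirchSwinnertonDyer-21396`, helper)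

WHY. Stub S5b of skeleton v4 asks for the connectivity of the lender `E₀`'s core graph FROM THE BOTTOM `∅`; Howard's Prop. 2.4.11
in the tree's form (`AdditiveKoly.selQP_coreConnected`) starts from a level of total canonical rank `≤ 1`. This file supplies that
input for the lender at `∅`: on the (γ)-avatar locus the certificate «a Heegner point `y₀ ∈ E₀(K)` is not `p`-divisible in `E₀(ℚ_p)`»
makes `y₀` a Heegner point of infinite order not divisible by `p` in `E₀(K)`; Kolyvagin's theorem (`kolyvagin`, rank one and `Ш(E₀/K)`
finite) and Kolyvagin's bound (`Kolyvagin1990_padicValNat_card_sha_le`, `ord_p #Ш ≤ 2 ord_p [E₀(K) : ℤ y₀]`) — both conjuncts of the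
route's displayed bundle `PublishedInputsAdditiveKoly`, read at `(N₀, E₀, K)` — then give `#Sel_p(E₀/K) = p` by the exact descent count
(`natCard_selmerGroup_eq`, AEC X.4.2), i.e. total canonical rank ONE at the bottom (`finrank_selQP_empty_add_eq_one_iff`).

* `padicValNat_index_zmultiples_eq_zero_of_not_exists_zsmul` — `E(K)[p] = 0` and `y ∉ p·E(K)` ⟹ `ord_p [E(K) : ℤ y] = 0` (pure group
  theory: an element of order `p` in `E(K)/ℤy` would give either `p`-torsion or a `p`-th root of `y`).
* `natCard_inf_torsionBy_eq_one_of_padicValNat_eq_zero` — `Ш` finite with `ord_p #Ш = 0` ⟹ `#Ш[p] = 1`.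
* `finrank_selQP_empty_add_eq_one_of_certificate` — the statement above.

HONEST FRAMING: theorems only; 0 definitions, 0 named facts, 0 `sorry`; CONDITIONAL on the two Kolyvagin facts (hypotheses, in
print: Kolyvagin 1990 Thm. A; Gross 1991 Thm. 1.3). Closes nothing; BSD is NOT proved by any of this.

References: [cite: GrossLMS1991, §1 Thm. 1.3, §2 Prop. 2.1 (2), (2.2)] [cite: KolyvaginEulerSystems1990, Thm. A]
[cite: SilvermanAEC2009, Thm. X.4.2].
-/

set_option linter.dupNamespace false -- single-conjunct summit repeats the name by design

noncomputable section

open scoped Classical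

namespace Summit.BirchSwinnertonDyer.BirchSwinnertonDyer.Theorems.AdditiveKoly

open WeierstrassCurve NumberField IsDedekindDomain Field
  Literature.NumberTheory.EllipticCurves Literature.NumberTheory.EllipticCurves.ModularForms
  Literature.NumberTheory.GaloisRepresentations Summit.BirchSwinnertonDyer.Rank1Residual Module
  Summit.BirchSwinnertonDyer.Rank1Residual.X11b.Three.Koly Literature.Algebra.Module

/-! ## §1 Two pieces of group theory -/

section GroupTheory

/-- **No `p`-torsion and `y ∉ p·A` ⟹ `ord_p [A : ℤy] = 0`.** If `A[p] = 0` and `y` is not `p`-divisible in `A`, then the index of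
`ℤ y` has `p`-adic valuation `0` (if the index is `0`, by convention; otherwise `p ∤` index): an element of order `p` in `A/ℤy` is a
`Q ∉ ℤy` with `p Q = k y`; if `p ∣ k` then `Q − (k/p) y ∈ A[p] = 0`, and if `p ∤ k` then `ap + bk = 1` makes `y = p(ay + bQ)`.
[folklore] -/
theorem padicValNat_index_zmultiples_eq_zero_of_not_exists_zsmul {A : Type*} [AddCommGroup A] {p : ℕ} [hp : Fact p.Prime]
    (htors : AddSubgroup.torsionBy A (p : ℤ) = ⊥) {y : A} (hy : ¬ ∃ Q : A, (p : ℤ) • Q = y) :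
    padicValNat p (AddSubgroup.zmultiples y).index = 0 := by
  by_cases h0 : (AddSubgroup.zmultiples y).index = 0
  · rw [h0, padicValNat_zero_right]
  refine padicValNat.eq_zero_of_not_dvd fun hdvd ↦ ?_
  set H := AddSubgroup.zmultiples y with hH
  haveI : Finite (A ⧸ H) := by
    by_contra hinf
    rw [not_finite_iff_infinite] at hinf
    exact h0 (AddSubgroup.index_eq_zero_iff_infinite.mpr hinf)
  haveI := Fintype.ofFinite (A ⧸ H)
  have hcard : p ∣ Fintype.card (A ⧸ H) := by
    rwa [← Nat.card_eq_fintype_card, ← AddSubgroup.index_eq_card]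
  obtain ⟨q, hq⟩ := exists_prime_addOrderOf_dvd_card p hcard
  obtain ⟨Q, rfl⟩ := QuotientAddGroup.mk_surjective q
  have hpQ : (p : ℤ) • Q ∈ H := by
    rw [← QuotientAddGroup.eq_zero_iff, QuotientAddGroup.mk_zsmul, natCast_zsmul, ← hq, addOrderOf_nsmul_eq_zero]
  have hQ : Q ∉ H := by
    intro hQH
    have h1 : (QuotientAddGroup.mk Q : A ⧸ H) = 0 := (QuotientAddGroup.eq_zero_iff Q).mpr hQH
    have : addOrderOf (QuotientAddGroup.mk Q : A ⧸ H) = 1 := by rw [h1, addOrderOf_zero]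
    rw [hq] at this
    exact hp.out.one_lt.ne' this
  obtain ⟨k, hk⟩ := AddSubgroup.mem_zmultiples_iff.mp hpQ
  by_cases hpk : (p : ℤ) ∣ k
  · obtain ⟨k', rfl⟩ := hpk
    apply hQ
    have hmem : Q - k' • y ∈ AddSubgroup.torsionBy A (p : ℤ) := by
      refine AddSubgroup.torsionBy.nsmul_iff.mpr ?_
      rw [← natCast_zsmul, smul_sub, ← hk, smul_smul, sub_self]
    rw [htors, AddSubgroup.mem_bot, sub_eq_zero] at hmem
    rw [hmem]
    exact AddSubgroup.zsmul_mem_zmultiples y k'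
  · have hcop : IsCoprime (p : ℤ) k := (Nat.prime_iff_prime_int.mp hp.out).irreducible.coprime_iff_not_dvd.mpr hpk
    obtain ⟨a, b, hab⟩ := hcop
    apply hy
    refine ⟨a • y + b • Q, ?_⟩
    calc (p : ℤ) • (a • y + b • Q) = a • ((p : ℤ) • y) + b • ((p : ℤ) • Q) := by
          rw [smul_add, smul_comm (p : ℤ) a, smul_comm (p : ℤ) b]
      _ = a • ((p : ℤ) • y) + b • (k • y) := by rw [hk]
      _ = (a * p + b * k) • y := by rw [add_smul, mul_smul, mul_smul]
      _ = y := by rw [hab, one_smul]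

/-- **`Ш` finite with `ord_p #Ш = 0` ⟹ `#Ш[p] = 1`** (for any subgroup `S` of an abelian group in place of `Ш ≤ H¹(K, E)`): `S[p]` is a
finite group killed by `p` whose order divides `#S`, which is prime to `p`; by Cauchy it has no element of prime order, so it is trivial.
[folklore] -/
theorem natCard_inf_torsionBy_eq_one_of_padicValNat_eq_zero {B : Type*} [AddCommGroup B] (S : AddSubgroup B) [Finite S]
    {p : ℕ} [hp : Fact p.Prime] (h : padicValNat p (Nat.card S) = 0) :
    Nat.card (S ⊓ AddSubgroup.torsionBy B ((p ^ 1 : ℕ) : ℤ) : AddSubgroup B) = 1 := by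
  rw [← natCard_torsionBy_addSubgroup S]
  have hdvd : Nat.card (AddSubgroup.torsionBy S ((p ^ 1 : ℕ) : ℤ)) ∣ Nat.card S :=
    AddSubgroup.card_addSubgroup_dvd_card _
  have hS0 : Nat.card S ≠ 0 := Nat.card_pos.ne'
  have hnp : ¬ p ∣ Nat.card S := by
    intro hd
    rcases padicValNat.eq_zero_iff.mp h with h1 | h1 | h1
    · exact hp.out.one_lt.ne' h1
    · exact hS0 h1
    · exact h1 hd
  by_contra hne
  obtain ⟨q, hq, hqd⟩ := Nat.exists_prime_and_dvd hne
  haveI : Fact q.Prime := ⟨hq⟩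
  haveI := Fintype.ofFinite (AddSubgroup.torsionBy S ((p ^ 1 : ℕ) : ℤ))
  obtain ⟨x, hx⟩ := exists_prime_addOrderOf_dvd_card (G := AddSubgroup.torsionBy S ((p ^ 1 : ℕ) : ℤ)) q
    (by rwa [← Nat.card_eq_fintype_card])
  have hpx : (p ^ 1) • x = 0 := AddSubgroup.torsionBy.nsmul (n := p ^ 1) x
  have hqp : q ∣ p ^ 1 := by
    rw [← hx]
    exact addOrderOf_dvd_of_nsmul_eq_zero hpx
  rw [pow_one] at hqp
  have hqp' : q = p := (Nat.prime_dvd_prime_iff_eq hq hp.out).mp hqp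
  subst hqp'
  exact hnp (hqd.trans hdvd)

end GroupTheory

/-! ## §2 The lender's bottom rank on the (γ)-avatar locus -/

section Lender

variable (W₀ : WeierstrassCurve ℚ) [W₀.IsElliptic] [W₀.IsGloballyMinimal] [NeZero (W₀.conductorNorm ℤ)]
  (p : ℕ) [hp : Fact p.Prime] (K : Type) [Field K] [NumberField K] (c : K ≃ₐ[ℚ] K)
  [Module (ZMod p) (Vp W₀ K p)]

/-- **THE LENDER's BOTTOM RANK IS ONE on the (γ)-avatar locus.** For `E₀ = W₀` globally minimal, `p ≥ 5` GOOD NON-ANOMALOUS for `E₀`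
(`a_p(E₀) ≢ 1`), `ρ̄_{E₀,p}` onto, `K` imaginary quadratic with the Heegner hypothesis for `N₀`, a complex conjugation `c`, a
parametrisation `Dt₀`, an embedding `ι : K → ℂ` and `ιp : K → ℚ_p`, granted Kolyvagin's theorem `kolyvagin` and Kolyvagin's bound
`Kolyvagin1990_padicValNat_card_sha_le` at `(N₀, E₀, K)` (both conjuncts of the route's `PublishedInputsAdditiveKoly`): if some Heegner
point `y₀ ∈ E₀(K)` over `heegnerPointComplex Dt₀ H₀` is NOT `p`-divisible in `E₀(ℚ_p)` along `ιp`, then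
`dim_𝔽_p Sel_∅⁺ + dim_𝔽_p Sel_∅⁻ = 1` for `E₀` (i.e. `#Sel_p(E₀/K) = p`). Road: `y₀` has infinite order
(`not_isOfFinAddOrder_and_padicLogOrd_eq_one_of_not_exists_zsmul_eq`) and is not `p`-divisible in `E₀(K)`; Kolyvagin gives rank one and
`Ш(E₀/K)` finite, `E₀(K)[p] = 0` (`ρ̄` irreducible), §1 gives `ord_p [E₀(K) : ℤy₀] = 0`, the bound gives `ord_p #Ш = 0`, so `#Ш[p] = 1`
(§1) and `#Sel_p = p^1 · 1 · 1` (`natCard_selmerGroup_eq`, AEC X.4.2(a)); conclude by `finrank_selQP_empty_add_eq_one_iff`.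
[cite: GrossLMS1991, §1 Thm. 1.3, §2 Prop. 2.1 (2)] [cite: KolyvaginEulerSystems1990, Thm. A] [cite: SilvermanAEC2009, Thm. X.4.2] -/
theorem finrank_selQP_empty_add_eq_one_of_certificate
    (hKo : kolyvagin (W₀.conductorNorm ℤ) W₀ K)
    (hB : Kolyvagin1990_padicValNat_card_sha_le (W₀.conductorNorm ℤ) W₀ K)
    (hp5 : 5 ≤ p) (hs₀ : W₀.HasSurjectiveModNGaloisRep p) (hgood₀ : W₀.HasGoodReductionAtPrime p)
    (hna : ¬ (p : ℤ) ∣ W₀.frobeniusTrace p - 1) (hK : IsImaginaryQuadratic K)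
    (hH₀ : SatisfiesHeegnerHypothesis (W₀.conductorNorm ℤ) K)
    (Dt₀ : ModularParametrizationData W₀ (W₀.conductorNorm ℤ)) (ι : K →+* ℂ) (ιp : K →+* ℚ_[p])
    (hcert : ∃ (H₀ : HeegnerDatum (W₀.conductorNorm ℤ) (NumberField.discr K)) (y₀ : (W₀.baseChange K).toAffine.Point),
      WeierstrassCurve.Affine.Point.map ι.toRatAlgHom y₀ = heegnerPointComplex Dt₀ H₀ ∧
        ¬ ∃ Q : (W₀.baseChange ℚ_[p]).toAffine.Point, (p : ℤ) • Q = X11b.padicPointOf W₀ p ιp y₀) :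
    finrank (ZMod p) (SelQP W₀ K p c ∅ true) + finrank (ZMod p) (SelQP W₀ K p c ∅ false) = 1 := by
  obtain ⟨H₀, y₀, hy₀, hndiv⟩ := hcert
  have hpp : p.Prime := hp.out
  have hp2 : p ≠ 2 := by omega
  have hcc : c * c = 1 := Method2.algEquiv_mul_self_eq_one K hK c
  rw [finrank_selQP_empty_add_eq_one_iff W₀ K p hp2 hK c hcc]
  -- the certificate's point is a Heegner point of infinite order, not `p`-divisible in `E₀(K)`
  have hP : IsHeegnerPoint (W₀.conductorNorm ℤ) W₀ K y₀ := ⟨Dt₀, H₀, ι, hy₀⟩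
  have hnt : ¬ IsOfFinAddOrder y₀ :=
    (not_isOfFinAddOrder_and_padicLogOrd_eq_one_of_not_exists_zsmul_eq W₀ p (by omega) hgood₀ hna ιp hndiv).1
  have hndivK : ¬ ∃ Q : (W₀.baseChange K).toAffine.Point, (p : ℤ) • Q = y₀ := by
    rintro ⟨Q, hQ⟩
    exact hndiv ⟨X11b.padicPointOf W₀ p ιp Q, by rw [← hQ]; simp only [X11b.padicPointOf, map_zsmul]⟩
  -- Kolyvagin: rank one, `Ш(E₀/K)` finite; no `p`-torsion over `K`
  obtain ⟨hrank, hfin⟩ := hKo hK hH₀ hP hnt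
  haveI : NeZero (p : ℚ) := ⟨by exact_mod_cast hpp.ne_zero⟩
  have hirr : W₀.HasIrreducibleModPGaloisRep p := hasIrreducibleModPGaloisRep_of_hasSurjectiveModNGaloisRep W₀ p hs₀
  have htors : AddSubgroup.torsionBy (W₀.baseChange K).toAffine.Point (p : ℤ) = ⊥ :=
    torsionBy_eq_bot_of_isImaginaryQuadratic_of_hasIrreducibleModPGaloisRep W₀ K hK hpp hirr
  -- `ord_p [E₀(K) : ℤ y₀] = 0`, hence `ord_p #Ш(E₀/K) = 0` (Kolyvagin's bound)
  have hidx := padicValNat_index_zmultiples_eq_zero_of_not_exists_zsmul htors hndivK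
  have hsha0 : padicValNat p (Nat.card (W₀.baseChange K).sha) = 0 := by
    have := hB hK hH₀ hP hnt hpp hp2 hs₀
    omega
  haveI : Finite (W₀.baseChange K).sha := hfin
  have hShap : Nat.card ((W₀.baseChange K).sha ⊓ AddSubgroup.torsionBy (W₀.baseChange K).galH1 ((p ^ 1 : ℕ) : ℤ) :
      AddSubgroup (W₀.baseChange K).galH1) = 1 := natCard_inf_torsionBy_eq_one_of_padicValNat_eq_zero _ hsha0
  have htor1 : Nat.card (AddSubgroup.torsionBy (W₀.baseChange K).toAffine.Point (((p ^ 1 : ℕ) : ℤ))) = 1 := by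
    rw [pow_one, htors, AddSubgroup.card_bot]
  rw [(W₀.baseChange K).natCard_selmerGroup_eq (n := p ^ 1) (pow_ne_zero 1 hpp.ne_zero), hrank, htor1, hShap, pow_one,
    pow_one, mul_one, mul_one]

end Lender

end Summit.BirchSwinnertonDyer.BirchSwinnertonDyer.Theorems.AdditiveKoly

end
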